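import Literature.MathematicalPhysics.QuantumLattice.HubbardNNNHoppingCorrelatorWindowCertificate
import HarnessLib

/-!
# `t–t'` Hubbard model: the window certificate bounds the translation-averaged pair correlator
# `L⁻² Σ_x Re ⟨ψ, Δ_x† Δ_{x+r} ψ⟩` of EVERY sector ground state, uniformly in `L`

Family `hubbard` (topic `MathematicalPhysics/QuantumLattice`). The dictionary between the window form
of the pair-correlation objective and the torus quantity tabulated by finite-size studies
(Scalapino 1995 §2: `P(r) = L⁻² Σ_x ⟨Δ_x† Δ_{x+r}⟩`, `Δ_x` the singlet pair with form factor `g`):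

* `windowPairCorrObs S g r h0 hr ∈ 𝔄_{Λ'}` — the window observable `P_0† P_r` (`P_x = localPairAt S g x`
  on its pair region `{x} ∪ (x + S)`), for a window `Λ' ⊇ pairRegion S 0 ∪ pairRegion S r`;
* `fermionEmbed_toTorusEmb_windowPairCorrObs` — its pull-back into the torus of side `L` is
  `(localPairOn S g L 0)ᴴ * localPairOn S g L (r mod L)`;
* `sum_conj_fockTranslate_localPair_corr` — `Σ_w U_w (Δ_0† Δ_r̄) U_wᴴ = Σ_x Δ_x† Δ_{x+r̄}`
  (`relabel_translate_localPair`), and `sum_spaceGroupUnitary_singleton_one_conj` — for the trivial point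
  group `S = {1}` the space-group family `spaceGroupUnitary {1}` is the translation family;
* `star_dotProduct_pairCorrSum_mulVec_eq` — hence `⟨ψ, (Σ_x Δ_x† Δ_{x+r̄}) ψ⟩ = L² · ω̄_ψ(Δ_0† Δ_r̄)`
  with `ω̄_ψ = orbitState (spaceGroupUnitary {1}) ψ` the translation-averaged vector state.

Consequently (`re_pairCorrSum_groundState_ge_of_window_certificate_TT'`): ONE window certificate for the
objective `windowPairCorrObs ({0} ∪ unitSteps) g r` with translation reductions and the energy
constraint `κ (u·1 − Γ E^{tt'}_Φ)`, `κ ≥ 0`, gives for EVERY `L ≥ 3` (window fits), every `n ≤ L²`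
with `groundEnergy (hubbardTorusTT' L t t' U) (2n) ≤ u L²`, and EVERY unit ground state `ψ` of the
sector `(2n, S^z = 0)`:
`c − Σₖ ‖aₖ‖ + (Σ_σ μ_σ)(n/L² − ν) ≤ L⁻² Re ⟨ψ, (Σ_x Δ_x† Δ_{x + r̄}) ψ⟩`
— a lower bound on the translation-averaged pair correlator at distance `r`, uniform in `L` and
valid on degenerate ground levels; the mirror certificate for `−P_0† P_r` gives the upper bound.
HONEST FRAMING: this is the soundness edge of a finite-size / thermodynamic-limit correlator table
(ladder R1–R4 with certified numbers); it makes no claim on the Hubbard ground state itself.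

## References
* D. J. Scalapino, Phys. Rep. 250 (1995) 329, §2 eq. (2.2)–(2.3). [cite: Scalapino1995, §2]
* J. Wang et al., PRX 14 (2024) 031006, §III. [cite: WangEtAl2024, §III]
* X. Han, arXiv:2006.06002 (2020), §2–3. [cite: Han2020Bootstrap, §3]
-/

noncomputable section

namespace Literature.MathematicalPhysics.QuantumLattice

open Matrix Finset HubbardWave0 Literature.Probability.LatticeModels
open Literature.MathematicalPhysics.QuantumManyBody.StateRelaxation
open scoped ComplexOrder BigOperators

/-! ## The window pair-correlation observable and its pull-back -/

section WindowPair

/-- **The window observable `P_0† P_r`** in `𝔄_{Λ'}`, `Λ' ⊇ pairRegion S 0 ∪ pairRegion S r`, with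
`P_x = localPairAt S g x = Σ_{e ∈ S} (g e/√2)(c_{x↑} c_{x+e,↓} − c_{x↓} c_{x+e,↑})`.
Scalapino 1995 §2 eq. (2.2)–(2.3). [cite: Scalapino1995, §2 eq. (2.3)] -/
def windowPairCorrObs (S : Finset (Site 2)) (g : Site 2 → ℝ) {Λ' : Finset (Site 2)} (r : Site 2)
    (h0 : pairRegion S 0 ⊆ Λ') (hr : pairRegion S r ⊆ Λ') : FermionOp Λ' :=
  (fermionEmbed (PolySite.incl h0) (localPairAt S g 0))ᴴ * fermionEmbed (PolySite.incl hr) (localPairAt S g r)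

/-- `0 mod L = 0`. [folklore] -/
private theorem proj_zero_site (L : ℕ) : Torus.proj L (0 : Site 2) = 0 := by
  funext i; simp [Torus.proj]

variable (L : ℕ) [NeZero L]

/-- **Pull-back of the window pair observable**: `Γ(ι_{Λ',L}) (P_0† P_r) = (P^L_0)ᴴ P^L_{r mod L}` with the
torus pairs `localPairOn S g L`. Scalapino 1995 §2. [cite: Scalapino1995, §2 eq. (2.3)] -/
theorem fermionEmbed_toTorusEmb_windowPairCorrObs (S : Finset (Site 2)) (g : Site 2 → ℝ)
    {Λ' : Finset (Site 2)} (r : Site 2) (h0 : pairRegion S 0 ⊆ Λ') (hr : pairRegion S r ⊆ Λ')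
    (hInj' : Set.InjOn (Torus.proj (d := 2) L) ↑Λ') :
    fermionEmbed (PolySite.toTorusEmb L hInj') (windowPairCorrObs S g r h0 hr) =
      (localPairOn S g L 0)ᴴ * localPairOn S g L (Torus.proj L r) := by
  rw [windowPairCorrObs, fermionEmbed_mul, fermionEmbed_conjTranspose, fermionEmbed_toTorusEmb_incl h0 hInj',
    fermionEmbed_toTorusEmb_incl hr hInj', fermionEmbed_toTorusEmb_localPairAt, fermionEmbed_toTorusEmb_localPairAt,
    proj_zero_site]

/-- The `d`-wave / extended-`s` case `S = {0} ∪ unitSteps`: the pull-back is `(localPair g L 0)ᴴ *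
localPair g L (r mod L)`. [cite: Scalapino1995, §2 eq. (2.3)] -/
theorem fermionEmbed_toTorusEmb_windowPairCorrObs_localPair (g : Site 2 → ℝ) {Λ' : Finset (Site 2)}
    (r : Site 2) (h0 : pairRegion (insert 0 unitSteps) 0 ⊆ Λ') (hr : pairRegion (insert 0 unitSteps) r ⊆ Λ')
    (hInj' : Set.InjOn (Torus.proj (d := 2) L) ↑Λ') :
    fermionEmbed (PolySite.toTorusEmb L hInj') (windowPairCorrObs (insert 0 unitSteps) g r h0 hr) =
      (localPair g L 0)ᴴ * localPair g L (Torus.proj L r) := by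
  rw [fermionEmbed_toTorusEmb_windowPairCorrObs, localPairOn_insert_zero_unitSteps,
    localPairOn_insert_zero_unitSteps]

end WindowPair

/-! ## Translation averaging of `Δ_0† Δ_r` -/

section Translation

variable {L : ℕ} [NeZero L]

/-- (Local to this section, as in `HubbardNNNHoppingCorrelatorCertificate`.) [folklore] -/
local instance (priority := high) instDecidableEqFermionTorusPairCorrTT : DecidableEq (FermionTorus 2 L) :=
  LinearOrder.toDecidableEq

/-- **`Σ_w U_w (Δ_0† Δ_r) U_wᴴ = Σ_x Δ_x† Δ_{x+r}`** (`U_w Δ_z U_wᴴ = Δ_{z+w}`,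
`relabel_translate_localPair`). Scalapino 1995 §2 eq. (2.3). [cite: Scalapino1995, §2 eq. (2.3)] -/
theorem sum_conj_fockTranslate_localPair_corr (g : Site 2 → ℝ) (r : TorusSite 2 L) :
    ∑ w : TorusSite 2 L, (fockTranslate w).val * ((localPair g L 0)ᴴ * localPair g L r) * (fockTranslate w).valᴴ =
      ∑ x : TorusSite 2 L, (localPair g L x)ᴴ * localPair g L (x + r) := by
  refine Finset.sum_congr rfl fun w _ => ?_
  rw [← relabel_eq_fockRelabel_conj, relabel_mul, relabel_conjTranspose, relabel_translate_localPair,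
    relabel_translate_localPair, zero_add, add_comm]

/-- For the trivial point group `S = {1}` the space-group family is the translation family:
`Σ_{g ∈ (ℤ/Lℤ)² × {1}} V_g X V_gᴴ = Σ_w U_w X U_wᴴ`. [cite: Han2020Bootstrap, §2 eq. (2)] -/
theorem sum_spaceGroupUnitary_singleton_one_conj
    (X : Matrix (Finset (Orb (FermionTorus 2 L))) (Finset (Orb (FermionTorus 2 L))) ℂ) :
    ∑ g : TorusSite 2 L × ↥(({1} : Finset (DihedralGroup 4))),
        spaceGroupUnitary ({1} : Finset (DihedralGroup 4)) g * X * (spaceGroupUnitary ({1} : Finset (DihedralGroup 4)) g)ᴴ =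
      ∑ w : TorusSite 2 L, (fockTranslate w).val * X * (fockTranslate w).valᴴ := by
  rw [Fintype.sum_prod_type]
  refine Finset.sum_congr rfl fun w _ => ?_
  have hg : ∀ γ : ↥(({1} : Finset (DihedralGroup 4))),
      spaceGroupUnitary ({1} : Finset (DihedralGroup 4)) (w, γ) = (fockTranslate w).val := by
    rintro ⟨γ, hγ⟩
    have h1 : γ = 1 := Finset.mem_singleton.1 hγ
    subst h1
    show (fockTranslate w).val * (fockD4 (L := L) ((1 : DihedralGroup 4))).val = _
    rw [map_one]
    exact Matrix.mul_one _
  rw [Finset.sum_congr rfl fun γ _ => by rw [hg γ], Finset.sum_const, Finset.card_univ, Fintype.card_coe,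
    Finset.card_singleton, one_smul]

/-- **`⟨ψ, (Σ_x Δ_x† Δ_{x+r}) ψ⟩ = L² · ω̄_ψ(Δ_0† Δ_r)`** with `ω̄_ψ` the translation-averaged vector state
(`orbitState (spaceGroupUnitary {1}) ψ`). Scalapino 1995 §2 eq. (2.3); Han 2020 §2 eq. (2).
[cite: Scalapino1995, §2 eq. (2.3)] -/
theorem star_dotProduct_pairCorrSum_mulVec_eq (g : Site 2 → ℝ) (r : TorusSite 2 L)
    (ψ : Fock (Orb (FermionTorus 2 L))) :
    star ψ ⬝ᵥ ((∑ x : TorusSite 2 L, (localPair g L x)ᴴ * localPair g L (x + r)) *ᵥ ψ) =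
      ((L ^ 2 : ℕ) : ℂ) *
        orbitState (spaceGroupUnitary ({1} : Finset (DihedralGroup 4))) ψ ((localPair g L 0)ᴴ * localPair g L r) := by
  rw [← sum_conj_fockTranslate_localPair_corr, ← sum_spaceGroupUnitary_singleton_one_conj,
    star_dotProduct_sum_spaceGroup_conj_mulVec (Finset.mem_singleton_self _)]
  congr 1
  push_cast
  rw [Finset.card_singleton]
  push_cast
  ring

/-- **The translation-averaged state on `Δ_0† Δ_r`, as the normalised torus sum**:
`Re ω̄_ψ(Δ_0† Δ_r) = Re ⟨ψ, (Σ_x Δ_x† Δ_{x+r}) ψ⟩ / L²`. Scalapino 1995 §2 eq. (2.3)–(2.4).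
[cite: Scalapino1995, §2 eq. (2.4)] -/
theorem re_orbitState_localPair_corr_eq_div (g : Site 2 → ℝ) (r : TorusSite 2 L)
    (ψ : Fock (Orb (FermionTorus 2 L))) :
    (orbitState (spaceGroupUnitary ({1} : Finset (DihedralGroup 4))) ψ ((localPair g L 0)ᴴ * localPair g L r)).re =
      (star ψ ⬝ᵥ ((∑ x : TorusSite 2 L, (localPair g L x)ᴴ * localPair g L (x + r)) *ᵥ ψ)).re / (L : ℝ) ^ 2 := by
  have hLr : ((L : ℝ)) ^ 2 ≠ 0 := pow_ne_zero 2 (Nat.cast_ne_zero.2 (NeZero.ne L))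
  rw [star_dotProduct_pairCorrSum_mulVec_eq]
  have hc : ((L ^ 2 : ℕ) : ℂ) = ((((L : ℝ)) ^ 2 : ℝ) : ℂ) := by push_cast; ring
  rw [hc, Complex.re_ofReal_mul, mul_div_cancel_left₀ _ hLr]

end Translation

/-! ## The uniform-in-`L` pair-correlator bound for every sector ground state -/

section GroundState

variable {L : ℕ} [NeZero L]

/-- (Local to this section.) [folklore] -/
local instance (priority := high) instDecidableEqFermionTorusPairCorrTT' : DecidableEq (FermionTorus 2 L) :=
  LinearOrder.toDecidableEq

/-- **Window certificate ⇒ uniform-in-`L` lower bound on the translation-averaged pair correlator of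
EVERY sector ground state.** Let a window certificate (data as in
`re_orbitState_ge_of_window_certificate_d4_TT'_ineq`, trivial point group: translation defects only,
`γₗ = 1`) hold for the objective `windowPairCorrObs ({0} ∪ unitSteps) g r`, with `κ ≥ 0`. Then for every
`L ≥ 3` with `x ↦ x mod L` injective on `thicken Λ' 1`, every `n ≤ |𝕋_L|` with
`groundEnergy (hubbardTorusTT' L t t' U) (2n) / L² ≤ u`, and every unit ground state `ψ` of the sector
`(2n, S^z = 0)`:
`c − Σₖ ‖aₖ‖ + (Σ_σ μ_σ)(n/L² − ν) ≤ Re ⟨ψ, (Σ_x Δ_x† Δ_{x + r̄}) ψ⟩ / L²` (`r̄ = r mod L`,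
`Δ_x = localPair g L x`). Wang et al. 2024 §III (energy-constrained reduced-density-matrix bootstrap)
in Han's translation-invariant form, read on finite tori. [cite: WangEtAl2024, §III] -/
theorem re_pairCorrSum_groundState_ge_of_window_certificate_TT' (t t' U : ℝ) (hL : 3 ≤ L)
    (g : Site 2 → ℝ) (r : Site 2) {nh : ℕ} (hn : nh ≤ Fintype.card (FermionTorus 2 L))
    {Λ Λ' : Finset (Site 2)} (hΛ : Λ ⊆ Λ') (h8 : thicken Λ 1 ⊆ Λ')
    (h0 : thicken ({0} : Finset (Site 2)) 1 ⊆ Λ') (hz : (0 : Site 2) ∈ Λ')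
    (hp0 : pairRegion (insert 0 unitSteps) 0 ⊆ Λ') (hpr : pairRegion (insert 0 unitSteps) r ⊆ Λ')
    (hInj : Set.InjOn (Torus.proj (d := 2) L) ↑(thicken Λ' 1))
    (hInj' : Set.InjOn (Torus.proj (d := 2) L) ↑Λ')
    {ψ : Fock (Orb (FermionTorus 2 L))}
    (hGS : IsGroundStateInSector (hubbardTorusTT' L t t' U) (2 * nh) 0 ψ) (hψ1 : star ψ ⬝ᵥ ψ = 1)
    {κ u : ℝ} (hκ : 0 ≤ κ) (hu : groundEnergy (hubbardTorusTT' L t t' U) (2 * nh) / (L : ℝ) ^ 2 ≤ u)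
    (μ : Fin 2 → ℝ) (ν : ℝ)
    {m : Type*} [Fintype m] [DecidableEq m] {Λm : Matrix m m ℂ} (hΛm : Λm.PosSemidef)
    (O : m → FermionOp Λ')
    {κ' : Type*} (s : Finset κ') (B : κ' → FermionOp Λ)
    {ι : Type*} (tt : Finset ι) (wv : ι → Site 2) (hsh : ∀ l, d4ShiftSet 1 (wv l) Λ ⊆ Λ') (Y : ι → FermionOp Λ)
    {ρ : Type*} (uu : Finset ρ) (b : ρ → ℂ) (cw : ρ → List (Orb (PolySite Λ') × Bool))
    (hcw : ∀ j ∈ uu, ladderCharge (cw j) ≠ 0 ∨ ladderSpinCharge (cw j) ≠ 0)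
    {δ : Type*} (ah : Finset δ) (dc : δ → ℝ) (V : δ → FermionOp Λ')
    {κ'' : Type*} (w : Finset κ'') (a : κ'' → ℂ) (word : κ'' → List (Orb (PolySite Λ') × Bool)) {c : ℝ}
    (hcert : windowPairCorrObs (insert 0 unitSteps) g r hp0 hpr - (c : ℂ) • (1 : FermionOp Λ') -
        ∑ σ : Fin 2, ((μ σ : ℝ) : ℂ) • (nAt 0 hz σ - ((ν : ℝ) : ℂ) • (1 : FermionOp Λ')) -
        ((κ : ℝ) : ℂ) • (((u : ℝ) : ℂ) • (1 : FermionOp Λ') -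
          fermionEmbed (PolySite.incl h0) ((hubbardTTPrimeFermionInteraction t t' U).meanEnergyObs 1)) =
      gramForm Λm O +
        (∑ k ∈ s, ((hubbardTTPrimeFermionInteraction t t' U).localHamiltonian Λ' * fermionEmbed (PolySite.incl hΛ) (B k) -
            fermionEmbed (PolySite.incl hΛ) (B k) * (hubbardTTPrimeFermionInteraction t t' U).localHamiltonian Λ') +
          ∑ l ∈ tt, (fermionEmbed (PolySite.incl (hsh l)) (fermionEmbed (PolySite.d4Emb 1 (wv l) Λ) (Y l)) -
            fermionEmbed (PolySite.incl hΛ) (Y l)) +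
          ∑ j ∈ uu, b j • ladderWord (cw j)) +
        (∑ m' ∈ ah, ((dc m' : ℝ) : ℂ) • ((V m')ᴴ - V m') + ∑ k ∈ w, a k • ladderWord (word k))) :
    c - ∑ k ∈ w, ‖a k‖ + (∑ σ : Fin 2, μ σ) * ((nh : ℝ) / (L : ℝ) ^ 2 - ν) ≤
      (star ψ ⬝ᵥ ((∑ x : TorusSite 2 L, (localPair g L x)ᴴ * localPair g L (x + Torus.proj L r)) *ᵥ ψ)).re /
        (L : ℝ) ^ 2 := by
  have h := re_orbitState_ge_of_window_certificate_d4_TT'_groundState t t' U hL hn hΛ h8 h0 hz hInj hInj'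
    (S := ({1} : Finset (DihedralGroup 4))) (Finset.mem_singleton_self _)
    (fun a ha b hb => by
      rw [Finset.mem_singleton] at ha hb ⊢
      rw [ha, hb, one_mul])
    hGS hψ1 hκ hu (windowPairCorrObs (insert 0 unitSteps) g r hp0 hpr) μ ν hΛm O s B tt (fun _ => 1)
    (fun _ _ => Finset.mem_singleton_self _) wv hsh Y uu b cw hcw ah dc V w a word hcert
  rw [fermionEmbed_toTorusEmb_windowPairCorrObs_localPair, re_orbitState_localPair_corr_eq_div] at h
  exact h

end GroundState

end Literature.MathematicalPhysics.QuantumLattice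

end
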